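import Summits.CriticalPhenomena.PercolationContinuityZ3.Theorems.PercShatteringRaceNearLinearTwoClusterDecayConsumedBoxLRO
import Summits.CriticalPhenomena.PercolationContinuityZ3.Theses.PercFiniteBoxLRO
import HarnessLib

/-!
# Crux `PercShatteringRace.NearLinearTwoClusterDecay` (stmt-CriticalPhenomena-5785) — the consumed form is served by `PercFiniteBoxLRO.PolyScaleLROOfTheta` (stmt-CriticalPhenomena-0858)

Helper file of the lead (seat c3) of the line `critical-orange-peeling`; lands with
`--supports stmt-CriticalPhenomena-5785` (registered stubs `raceLemma_of_polyScaleLRO`,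
`percolationContinuityZ3_of_powerSaving_of_polyScaleLRO`).

What the route's deciding theorem consumes of the crux `U(b)` is only the JUMP-WORLD IN-BOX LRO at
aspect `n^{1+b}` (`Consumed.raceLemma_of_jumpBoxLRO`, landed):
`0 < θ(p_c) → ∃ c > 0, ∀ᶠ n, ∀ y ∈ Λ(n), c ≤ P_{p_c}(0 ↔ y inside Λ(⌈n^{1+b}⌉))`.
The sibling route's crux `PercFiniteBoxLRO.PolyScaleLROOfTheta` (stmt-0858: for every `α > 1` and
every `p` with `θ(p) > 0`, `∃ ρ > 0`, `ρ ≤ P_p(x ↔ y inside Λ(⌈n^α⌉))` for all `n ≥ 1`, `x, y ∈ Λ(n)`)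
contains that form as its instance `α = 1 + b`, `p = p_c`, `x = 0`.  Hence (certified inter-route
edges): `S(a) ∧ PolyScaleLROOfTheta ⇒ θ(p_c) = 0` for all admissible `(a, b)`
(`raceLemma_of_polyScaleLRO`), and the filed instance
`FreeSusceptibilityPowerSaving ∧ PolyScaleLROOfTheta ⇒ PercolationContinuityZ3`
(`percolationContinuityZ3_of_powerSaving_of_polyScaleLRO`): in route PercShatteringRace the `U`-slot
can be served by stmt-0858 (indeed by its single instance `α = 7/6 < 6/5`) instead of the
unconditional two-cluster decay `U(1/6)`.  Pure logic over landed theorems.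
-/

noncomputable section

namespace Summit.CriticalPhenomena.PercolationContinuityZ3.Theorems.NearLinearTwoClusterDecay.Consumed

open MeasureTheory Filter Topology
open Literature.Probability.LatticeModels Literature.Probability.Percolation

/-- **The race from `PolyScaleLROOfTheta`** (registered stub `raceLemma_of_polyScaleLRO`): for real
`a, b` with `0 < b` and `(1 + b)(3 - a) < 3`, the free-box power saving `S(a)` at `p_c(ℤ³)` and the
sibling crux `PercFiniteBoxLRO.PolyScaleLROOfTheta` (jump-world in-box LRO at every polynomial scale)
give `θ(p_c) = 0`.  Proof: instance `α = 1 + b > 1`, `p = p_c`, `x = 0` of the LRO is exactly the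
consumed form of `Consumed.raceLemma_of_jumpBoxLRO`. [folklore] -/
theorem raceLemma_of_polyScaleLRO : ∀ a b : ℝ, 0 < b → (1 + b) * (3 - a) < 3 →
    (∃ C : ℝ, ∀ R : ℕ, 1 ≤ R → ∑ y ∈ box 3 R,
      (bondPercolation (zdGraph 3) (criticalProbI 3)).real (openConnIn (↑(box 3 R) : Set (Site 3)) 0 y)
        ≤ C * (R : ℝ) ^ (3 - a)) →
    Summit.CriticalPhenomena.PercolationContinuityZ3.Theses.PercFiniteBoxLRO.PolyScaleLROOfTheta →
    _root_.PercolationContinuityZ3 := by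
  intro a b hb hab hS hP
  refine raceLemma_of_jumpBoxLRO a b hb.le hab hS fun hθ => ?_
  obtain ⟨ρ, hρ, h⟩ := hP (1 + b) (by linarith) (criticalProbI 3) hθ
  exact ⟨ρ, hρ, Filter.eventually_atTop.2 ⟨1, fun n hn y hy => h n hn 0 (zero_mem_box 3 n) y hy⟩⟩

/-- **The filed instance** (registered stub `percolationContinuityZ3_of_powerSaving_of_polyScaleLRO`):
`FreeSusceptibilityPowerSaving` (`S(1/2)`) and `PercFiniteBoxLRO.PolyScaleLROOfTheta` (stmt-0858)
give `PercolationContinuityZ3` — the `U`-slot of route PercShatteringRace is served by stmt-0858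
(`(1 + 1/6)(3 - 1/2) = 35/12 < 3`). [folklore] -/
theorem percolationContinuityZ3_of_powerSaving_of_polyScaleLRO :
    Summit.CriticalPhenomena.PercolationContinuityZ3.Theses.PercShatteringRace.FreeSusceptibilityPowerSaving →
    Summit.CriticalPhenomena.PercolationContinuityZ3.Theses.PercFiniteBoxLRO.PolyScaleLROOfTheta →
    _root_.PercolationContinuityZ3 := by
  intro hS hP
  have h := raceLemma_of_polyScaleLRO (1 / 2) (1 / 6) (by norm_num) (by norm_num)
  have e1 : (3 : ℝ) - 1 / 2 = 5 / 2 := by norm_num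
  rw [e1] at h
  exact h hS hP

end Summit.CriticalPhenomena.PercolationContinuityZ3.Theorems.NearLinearTwoClusterDecay.Consumed
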